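import Literature.NumberTheory.Automorphic.UnitaryGroupPrincipalSeriesExponents
import Literature.NumberTheory.Automorphic.MatrixCoefficients
import HarnessLib

/-!
# Casselman's square-integrability criterion for `U(3)` over a `p`-adic field: an admissible `ω`-representation is square-integrable
# modulo the centre iff `ω` is unitary and every exponent `χ′` satisfies `|χ′(a)| < 1` on `A⁻ ∖ A(𝒪)` ([Casselman1995] Thm. 4.4.6, the case
# of `F`-rank one) — ONE NAMED FACT, CM instance at a non-split place

Topic `NumberTheory/Automorphic`; namespace `Literature.NumberTheory.Automorphic.UnitaryGroup`.  ONE NAMED FACT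
`def U3SquareIntegrableExponents (L) : Prop` (net debt +1, declared; a printed theorem used as a HYPOTHESIS); statement only; no `sorry`, no
instance, no notation.  Registry pub/hodgecm-mathlib F0∕P3, typer seat T3a: node N5 of the statement tree of ★ NF1 `Rogawski1990.KeysCaseTwo` (the
clause «`πⁿ(ξ)` is NOT square-integrable»: its only exponent is `wχ_ξ = (η̃₁ μ ‖·‖^{-1/2}, η₂)`, `|wχ_ξ(d(t,1,t⁻¹))| = |t|_F⁻¹ > 1`; and, with N5′, «`π²(ξ)`
IS»).  Vocabulary: ★ `Representation.HasJacquetExponent` (`Automorphic/UnitaryGroupPrincipalSeriesExponents`), ★ `cmBorelTriple`, ★ `torusEntry`,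
★ `unitModulusChar` (`Automorphic/UnitaryGroupBorelInduction`), ★ `Representation.IsAdmissible` (`Automorphic/SmoothRepresentation`), ★
`Representation.IsSquareIntegrableModCenter` (`Automorphic/MatrixCoefficients`).

Source (read at the page).  [Casselman1995] draft 1 May 1995, §4.4 p. 45: «I call the restriction to `A` of the characters `χ` such that
`(V_N)_{χ,∞} ≠ 0` the central characters of `π` with respect to `P`. (These are what Harish-Chandra calls exponents in [20].) …
**Theorem 4.4.6.** Let `ω` be a character of `Z_G`. If `(π, V)` is an admissible `ω`-representation of `G`, then it is square-integrable if
and only if (a) `ω` is unitary; (b) for every `Θ ⊆ Δ`, if `χ` is a central character of `π` with respect to `P_Θ` then `|χ δ_∅^{-1/2}(a)| < 1` for all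
`a ∈ A_Θ⁻ ∖ A_∅(O)A_Δ`.»  Definitions: §1.4 p. 13 «`A_Θ⁻(ε) = {a ∈ A_Θ : |α(a)| ≤ ε for all α ∈ Δ ∖ Θ}`, `A_Θ⁻ = A_Θ⁻(1)`»; §2.5 p. 28 «an admissible
`ω`-representation of `G` … is said to be square-integrable modulo `Z` … if `|ω(z)| = 1` for every `z ∈ Z` and if for every `v ∈ V` and `ṽ ∈ Ṽ`,
the function `|c_{v,ṽ}(g)|` is square-integrable on `G/Z`».

THE INSTANCE (`F`-rank one).  `G = U(Φ₃)(L⁺_v)` at a NON-SPLIT finite place `v` (`E = L_w`, `F = L⁺_v`); `Δ = {α}`, so `Θ ∈ {∅, Δ}`: for `Θ = Δ`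
(`P = G`) condition (b) is EMPTY (`A_Δ⁻ ∖ A_∅(O)A_Δ = ∅`, `A_Δ = 1`: the centre `U(1) = E¹` is anisotropic); for `Θ = ∅`, `P_∅ = B = TN` (★
`cmBorelTriple L 3 v`), `M_∅ = T = {d(α, β, ᾱ⁻¹)}`, `A = A_∅ = {d(t, 1, t⁻¹) : t ∈ F^×}` (the maximal `F`-split torus), `α(d(t,1,t⁻¹)) = t` (action on
the root space `E₁₂ ⊂ Lie N`), `A⁻ ∖ A_∅(O)A_Δ = {d(t, 1, t⁻¹) : |t|_F < 1}`; `|t|_F < 1 ⇔ ‖t‖_E < 1` (★ `unitModulusChar` on `L_v`).  An element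
`a ∈ T` lies in `A` iff its entries satisfy `σ(a₀₀) = a₀₀` and `a₁₁ = 1` (then `a₂₂ = ā₀₀⁻¹ = a₀₀⁻¹`), ★ `torusEntry`.  EXPONENTS: the central
characters with respect to `B` read through the normalised Jacquet functor `r_B = (·)_N ⊗ δ_B^{-1/2}` (print's `χ δ^{-1/2}`) are the characters
`χ′` of `T` with ★ `π.HasJacquetExponent (cmBorelTriple L 3 v) χ′` (eigenvector form; `V_N` is finite-dimensional for admissible `π` by Jacquet's
lemma ★ `Representation.IsAdmissible.jacquetModule`, on which Casselman's generalised eigenspace `(V_N)_{χ,∞} ≠ 0` iff a `χ`-eigenvector exists).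
SQUARE-INTEGRABLE in Casselman's sense (§2.5: `|ω| = 1` AND `|c_{v,ṽ}| ∈ L²(G/Z)`) is typed as the conjunction `(∀ z, ‖ω z‖ = 1) ∧` ★
`π.IsSquareIntegrableModCenter μZ` (domination form, equivalent under `|ω| = 1` for the continuous coefficients of a smooth `π`).  TYPED EXACTLY
SO, for an arbitrary admissible representation `π` of `G` on which the centre acts by the character `ω` (hypothesis `hω`).
`-- TODO(general form): [Casselman1995, Thm. 4.4.6] for any connected reductive G over a non-archimedean local field, all Θ ⊆ Δ.`
HC_CM is proved only modulo the printed citations until rung 0 closes; this fact ENTERS that list only if a line consumes it.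

## References
* [Casselman1995] W. Casselman, *Introduction to the theory of admissible representations of `p`-adic reductive groups*,
  draft 1 May 1995, Thm. 4.4.6 p. 45; §1.4 p. 13; §2.5 p. 28; Thm. 6.5.1 pp. 64–65.
* [Rogawski1990] J. D. Rogawski, *Automorphic Representations of Unitary Groups in Three Variables*, Ann. of Math. Stud. 123
  (1990), §12.2 (2) p. 174 («It follows from the theory of matrix coefficients that `πⁿ(ξ)` is non-tempered»).
-/

noncomputable section

open MeasureTheory NumberField IsDedekindDomain
open scoped MatrixGroups NNReal

namespace Literature.NumberTheory.Automorphic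

namespace UnitaryGroup

variable (L : Type) [Field L] [NumberField L] [IsCMField L]

/-- **NAMED FACT (N5) — CASSELMAN'S SQUARE-INTEGRABILITY CRITERION FOR `U(3)` OVER A `p`-ADIC FIELD** [Casselman1995 Thm. 4.4.6, `F`-rank one]:
at every NON-SPLIT finite place `v` of `L⁺`, for every Haar measure `μZ` on `G ⧸ Z(G)`, `G = U(Φ₃)(L⁺_v)` (the carrier of ★ `cmPrincipalSeries`, `=`
`(cmDatum L 3 Φ₃).Local v` by ★ `cmDatum_Local_eq`), and every ADMISSIBLE representation `π` of `G` (★ `Representation.IsAdmissible`) on which the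
centre acts through a character `ω` (`π(z) x = ω(z) x`): `π` is square-integrable modulo the centre in Casselman's sense — `ω` unitary AND every
matrix coefficient square-integrable on `G/Z` (★ `Representation.IsSquareIntegrableModCenter μZ`) — IF AND ONLY IF (a) `ω` is unitary and (b) every
EXPONENT `χ′` of `π` with respect to the Borel triple `B = TN` (★ `π.HasJacquetExponent (cmBorelTriple L 3 v) χ′`, normalised: print's `χ δ^{-1/2}`)
satisfies `‖χ′(a)‖ < 1` for every `a = d(t, 1, t⁻¹) ∈ T` with `t ∈ L⁺_v^×` (`σ(a₀₀) = a₀₀`, `a₁₁ = 1`, ★ `torusEntry`) and `‖t‖_{L_v} < 1` (★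
`unitModulusChar`; print's `a ∈ A⁻ ∖ A_∅(O)A_Δ`).  Print: «Theorem 4.4.6. Let `ω` be a character of `Z_G`. If `(π, V)` is an admissible
`ω`-representation of `G`, then it is square-integrable if and only if (a) `ω` is unitary; (b) for every `Θ ⊆ Δ`, if `χ` is a central character of `π`
with respect to `P_Θ` then `|χδ^{-1/2}(a)| < 1` for all `a ∈ A_Θ⁻ ∖ A_∅(O)A_Δ`» (for `U(3)`: `Θ = Δ` contributes nothing, `Θ = ∅` is `B`).  Used as a
HYPOTHESIS; nothing in the tree proves it. [cite: Casselman1995, Thm. 4.4.6 p. 45; §1.4 p. 13; §2.5 p. 28] [cite: Rogawski1990, §12.2 (2) p. 174] -/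
def U3SquareIntegrableExponents : Prop :=
  ∀ (v : HeightOneSpectrum (𝓞 ↥(maximalRealSubfield L))),
    (∀ w : PlacesOver L v, IsCMField.complexConj L • w.1 = w.1) →
    ∀ [MeasurableSpace
          (↥(unitaryGroupOfForm (conjLocal L (IsCMField.complexConj L) v) (cmLocalForm L 3 v)) ⧸
            Subgroup.center ↥(unitaryGroupOfForm (conjLocal L (IsCMField.complexConj L) v) (cmLocalForm L 3 v)))]
      [BorelSpace
          (↥(unitaryGroupOfForm (conjLocal L (IsCMField.complexConj L) v) (cmLocalForm L 3 v)) ⧸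
            Subgroup.center ↥(unitaryGroupOfForm (conjLocal L (IsCMField.complexConj L) v) (cmLocalForm L 3 v)))]
      (μZ : Measure
          (↥(unitaryGroupOfForm (conjLocal L (IsCMField.complexConj L) v) (cmLocalForm L 3 v)) ⧸
            Subgroup.center ↥(unitaryGroupOfForm (conjLocal L (IsCMField.complexConj L) v) (cmLocalForm L 3 v))))
      [μZ.IsHaarMeasure],
    ∀ (V : Type) [AddCommGroup V] [Module ℂ V]
      (π : Representation ℂ ↥(unitaryGroupOfForm (conjLocal L (IsCMField.complexConj L) v) (cmLocalForm L 3 v)) V),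
      π.IsAdmissible →
    ∀ (ω : ↥(Subgroup.center ↥(unitaryGroupOfForm (conjLocal L (IsCMField.complexConj L) v) (cmLocalForm L 3 v))) →* ℂˣ),
      (∀ (z : ↥(Subgroup.center ↥(unitaryGroupOfForm (conjLocal L (IsCMField.complexConj L) v) (cmLocalForm L 3 v)))) (x : V),
        π (z : ↥(unitaryGroupOfForm (conjLocal L (IsCMField.complexConj L) v) (cmLocalForm L 3 v))) x = ((ω z : ℂˣ) : ℂ) • x) →
    haveI := locallyCompactSpace_cmBorelU L 3 v
    (((∀ z, ‖((ω z : ℂˣ) : ℂ)‖ = 1) ∧ π.IsSquareIntegrableModCenter μZ) ↔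
      ((∀ z, ‖((ω z : ℂˣ) : ℂ)‖ = 1) ∧
        ∀ χ' : ↥(cmBorelTriple L 3 v).M →* ℂˣ, π.HasJacquetExponent (cmBorelTriple L 3 v) χ' →
          ∀ a : ↥(cmBorelTriple L 3 v).M,
            conjLocal L (IsCMField.complexConj L) v
                ((torusEntry (conjLocal L (IsCMField.complexConj L) v) (cmLocalForm L 3 v) 0 a : (LocalRing L v)ˣ) : LocalRing L v) =
              ((torusEntry (conjLocal L (IsCMField.complexConj L) v) (cmLocalForm L 3 v) 0 a : (LocalRing L v)ˣ) : LocalRing L v) →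
            torusEntry (conjLocal L (IsCMField.complexConj L) v) (cmLocalForm L 3 v) 1 a = 1 →
            unitModulusChar (LocalRing L v) (torusEntry (conjLocal L (IsCMField.complexConj L) v) (cmLocalForm L 3 v) 0 a) < 1 →
            ‖((χ' a : ℂˣ) : ℂ)‖ < 1))

end UnitaryGroup

end Literature.NumberTheory.Automorphic

end
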